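import Literature.Probability.RandomPlanarGeometry.SAWPulledLargeForceExpansionZdWordTypesSixBlocks
import HarnessLib

/-!
# Axis types of length seven: the transversal `T7` (877 set partitions × 128 sign vectors = 112 256 types), and split histogram cells

Topic `Literature/Probability/RandomPlanarGeometry` (continuation of `…ZdWordTypesSix` / `…ZdWordTypesSixBlocks` one letter up: the
data needed to run the master formula `WordTypes.card_filter_eq_sum_transversal` at word length 7 — the length of the transverse words
of the seven-step self-avoiding walks whose one-step extensions are counted in «ZD-NINE-STEP»). [cite: MadrasSlade1993, Definition 1.2.4]

Structure as at length 6: restricted growth cuts the transversal `T7` out of the 645 120-tuple box `Box7` (letters of axis `≤ position`);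
COMPLETENESS (`canon_mem_T7`), the total-size identity (`count_T7`) and the master formula at length 7 (`card_filter_eq_sum_T7`) are
structural theorems.  The census cells of the sequel are SPLIT BY THE LAST LETTER (one kernel pass over 46 080 tuples each: an unsplit
pass over the whole box exceeds the elaborator's budget) and HISTOGRAM-VALUED (one pass returns the counts for every number of axes as a
list): `cntH g a₆` for a raw Boolean class test `g` on seven raw letters, with ★ `getD_cntH` (entry `k` of the list = the scalar split
cell `cnt7 g k a₆`), ★ `sum_cnt7_eq_card` (the scalar cells summed over the last letter = the `Finset` count over the canonical box) and
★ `card_good7_eq` (`#{u : Word 7 d | G u} = Σ_{k ≤ 7} n_k · d^{(k)}` from the cells).  No kernel enumeration in this file.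
The definitions `Box7`, `ofBox7`, `q0`…`q6`, `canonR7`, `canonB7`, `boxT7`, `T7`, `boxOf7`, `nax7`, `naxR7`, `letters7`, `leaf7`, `cnt7`,
`split7`, `bump`, `step7`, `cntH`, `blk7`, `bsum7`, `esum7`, `SAW7`, `UnitTail3`, `UnitTail5`, `UnitTail7`, `saw7R`, `unit3R`, `unit5R`, `unit7R` are this file's
tool notions (not notions in print).  No number is taken from print.

Provenance: lane «pcv-sawmu», a-p3 g19 (2026-08-26).
-/

open Finset
open scoped BigOperators
open Literature.Probability.LatticeModels
open Literature.Probability.RandomPlanarGeometry.SAW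

namespace Literature.Probability.RandomPlanarGeometry.SAW.Zd

namespace WordTypes

/-! ### The box and the transversal of length 7 -/

/-- The length-7 box: the letter at position `i` has axis `< i+1`. [cite: MadrasSlade1993, Definition 1.2.4] -/
abbrev Box7 : Type :=
  (Fin 1 × Bool) × (Fin 2 × Bool) × (Fin 3 × Bool) × (Fin 4 × Bool) × (Fin 5 × Bool) × (Fin 6 × Bool) × (Fin 7 × Bool)

/-- The word of a box tuple. [cite: MadrasSlade1993, Definition 1.2.4] -/
def ofBox7 (t : Box7) : Word 7 7 :=
  ![(Fin.castLE (by omega) t.1.1, t.1.2), (Fin.castLE (by omega) t.2.1.1, t.2.1.2), (Fin.castLE (by omega) t.2.2.1.1, t.2.2.1.2),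
    (Fin.castLE (by omega) t.2.2.2.1.1, t.2.2.2.1.2), (Fin.castLE (by omega) t.2.2.2.2.1.1, t.2.2.2.2.1.2),
    (Fin.castLE (by omega) t.2.2.2.2.2.1.1, t.2.2.2.2.2.1.2), t.2.2.2.2.2.2]

/-- `ofBox7` is injective. [cite: MadrasSlade1993, Definition 1.2.4] -/
theorem ofBox7_injective : Function.Injective ofBox7 := by
  intro t t' h
  have h0 := congrFun h 0
  have h1 := congrFun h 1
  have h2 := congrFun h 2
  have h3 := congrFun h 3
  have h4 := congrFun h 4
  have h5 := congrFun h 5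
  have h6 := congrFun h 6
  simp only [ofBox7, Matrix.cons_val_zero, Matrix.cons_val_one, Matrix.cons_val, Prod.mk.injEq, Fin.castLE_inj] at h0 h1 h2 h3 h4 h5 h6
  obtain ⟨⟨a0, b0⟩, ⟨a1, b1⟩, ⟨a2, b2⟩, ⟨a3, b3⟩, ⟨a4, b4⟩, ⟨a5, b5⟩, ⟨a6, b6⟩⟩ := t
  obtain ⟨⟨a0', b0'⟩, ⟨a1', b1'⟩, ⟨a2', b2'⟩, ⟨a3', b3'⟩, ⟨a4', b4'⟩, ⟨a5', b5'⟩, ⟨a6', b6'⟩⟩ := t'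
  simp only at h0 h1 h2 h3 h4 h5 h6
  obtain ⟨rfl, rfl⟩ := h0
  obtain ⟨rfl, rfl⟩ := h1
  obtain ⟨rfl, rfl⟩ := h2
  obtain ⟨rfl, rfl⟩ := h3
  obtain ⟨rfl, rfl⟩ := h4
  obtain ⟨rfl, rfl⟩ := h5
  obtain ⟨rfl, rfl⟩ := h6
  rfl

/-- The raw letters of a box tuple: letter 0. [cite: MadrasSlade1993, Definition 1.2.4] -/
def q0 (t : Box7) : ℕ × Bool := (t.1.1.val, t.1.2)
/-- Raw letter 1. [cite: MadrasSlade1993, Definition 1.2.4] -/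
def q1 (t : Box7) : ℕ × Bool := (t.2.1.1.val, t.2.1.2)
/-- Raw letter 2. [cite: MadrasSlade1993, Definition 1.2.4] -/
def q2 (t : Box7) : ℕ × Bool := (t.2.2.1.1.val, t.2.2.1.2)
/-- Raw letter 3. [cite: MadrasSlade1993, Definition 1.2.4] -/
def q3 (t : Box7) : ℕ × Bool := (t.2.2.2.1.1.val, t.2.2.2.1.2)
/-- Raw letter 4. [cite: MadrasSlade1993, Definition 1.2.4] -/
def q4 (t : Box7) : ℕ × Bool := (t.2.2.2.2.1.1.val, t.2.2.2.2.1.2)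
/-- Raw letter 5. [cite: MadrasSlade1993, Definition 1.2.4] -/
def q5 (t : Box7) : ℕ × Bool := (t.2.2.2.2.2.1.1.val, t.2.2.2.2.2.1.2)
/-- Raw letter 6. [cite: MadrasSlade1993, Definition 1.2.4] -/
def q6 (t : Box7) : ℕ × Bool := (t.2.2.2.2.2.2.1.val, t.2.2.2.2.2.2.2)

/-- The raw letters are the raw forms of the letters of `ofBox7 t`. [cite: MadrasSlade1993, Definition 1.2.4] -/
theorem raw_ofBox7 (t : Box7) :
    raw (ofBox7 t 0) = q0 t ∧ raw (ofBox7 t 1) = q1 t ∧ raw (ofBox7 t 2) = q2 t ∧ raw (ofBox7 t 3) = q3 t ∧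
      raw (ofBox7 t 4) = q4 t ∧ raw (ofBox7 t 5) = q5 t ∧ raw (ofBox7 t 6) = q6 t := by
  refine ⟨?_, ?_, ?_, ?_, ?_, ?_, ?_⟩ <;> simp [raw, ofBox7, q0, q1, q2, q3, q4, q5, q6]

/-- Restricted growth on seven raw letters (Boolean; extends `canonR`). [cite: MadrasSlade1993, Definition 1.2.4] -/
def canonR7 (a b c e f g h : ℕ × Bool) : Bool :=
  canonR a b c e f g && h.1.ble ((a.1 + 1) ⊔ ((b.1 + 1) ⊔ ((c.1 + 1) ⊔ ((e.1 + 1) ⊔ ((f.1 + 1) ⊔ (g.1 + 1))))))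

/-- The raw canonicity test of a box tuple. [cite: MadrasSlade1993, Definition 1.2.4] -/
def canonB7 (t : Box7) : Bool := canonR7 (q0 t) (q1 t) (q2 t) (q3 t) (q4 t) (q5 t) (q6 t)

/-- The raw test is restricted growth of the word. [cite: MadrasSlade1993, Definition 1.2.4] -/
theorem canonB7_iff (t : Box7) : canonB7 t = true ↔ GrowthOK (ofBox7 t) := by
  have f0 : (Finset.univ.filter fun q : Fin 7 => q < 0) = ∅ := by decide
  have f1 : (Finset.univ.filter fun q : Fin 7 => q < 1) = {0} := by decide
  have f2 : (Finset.univ.filter fun q : Fin 7 => q < 2) = {0, 1} := by decide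
  have f3 : (Finset.univ.filter fun q : Fin 7 => q < 3) = {0, 1, 2} := by decide
  have f4 : (Finset.univ.filter fun q : Fin 7 => q < 4) = {0, 1, 2, 3} := by decide
  have f5 : (Finset.univ.filter fun q : Fin 7 => q < 5) = {0, 1, 2, 3, 4} := by decide
  have f6 : (Finset.univ.filter fun q : Fin 7 => q < 6) = {0, 1, 2, 3, 4, 5} := by decide
  have e0 : (ofBox7 t 0).1.val = t.1.1.val := by simp [ofBox7]
  have e1 : (ofBox7 t 1).1.val = t.2.1.1.val := by simp [ofBox7]
  have e2 : (ofBox7 t 2).1.val = t.2.2.1.1.val := by simp [ofBox7]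
  have e3 : (ofBox7 t 3).1.val = t.2.2.2.1.1.val := by simp [ofBox7]
  have e4 : (ofBox7 t 4).1.val = t.2.2.2.2.1.1.val := by simp [ofBox7]
  have e5 : (ofBox7 t 5).1.val = t.2.2.2.2.2.1.1.val := by simp [ofBox7]
  have e6 : (ofBox7 t 6).1.val = t.2.2.2.2.2.2.1.val := by simp [ofBox7]
  have p0 : pm (ofBox7 t) 0 = 0 := by rw [pm, f0, Finset.sup_empty]; rfl
  have p1 : pm (ofBox7 t) 1 = t.1.1.val + 1 := by rw [pm, f1, Finset.sup_singleton, e0]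
  have p2 : pm (ofBox7 t) 2 = (t.1.1.val + 1) ⊔ (t.2.1.1.val + 1) := by
    rw [pm, f2, Finset.sup_insert, Finset.sup_singleton, e0, e1]
  have p3 : pm (ofBox7 t) 3 = (t.1.1.val + 1) ⊔ ((t.2.1.1.val + 1) ⊔ (t.2.2.1.1.val + 1)) := by
    rw [pm, f3, Finset.sup_insert, Finset.sup_insert, Finset.sup_singleton, e0, e1, e2]
  have p4 : pm (ofBox7 t) 4 = (t.1.1.val + 1) ⊔ ((t.2.1.1.val + 1) ⊔ ((t.2.2.1.1.val + 1) ⊔ (t.2.2.2.1.1.val + 1))) := by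
    rw [pm, f4, Finset.sup_insert, Finset.sup_insert, Finset.sup_insert, Finset.sup_singleton, e0, e1, e2, e3]
  have p5 : pm (ofBox7 t) 5 = (t.1.1.val + 1) ⊔ ((t.2.1.1.val + 1) ⊔ ((t.2.2.1.1.val + 1) ⊔ ((t.2.2.2.1.1.val + 1) ⊔
      (t.2.2.2.2.1.1.val + 1)))) := by
    rw [pm, f5, Finset.sup_insert, Finset.sup_insert, Finset.sup_insert, Finset.sup_insert, Finset.sup_singleton, e0, e1, e2,
      e3, e4]
  have p6 : pm (ofBox7 t) 6 = (t.1.1.val + 1) ⊔ ((t.2.1.1.val + 1) ⊔ ((t.2.2.1.1.val + 1) ⊔ ((t.2.2.2.1.1.val + 1) ⊔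
      ((t.2.2.2.2.1.1.val + 1) ⊔ (t.2.2.2.2.2.1.1.val + 1))))) := by
    rw [pm, f6, Finset.sup_insert, Finset.sup_insert, Finset.sup_insert, Finset.sup_insert, Finset.sup_insert, Finset.sup_singleton,
      e0, e1, e2, e3, e4, e5]
  unfold GrowthOK
  rw [Fin.forall_fin_succ, Fin.forall_fin_succ, Fin.forall_fin_succ, Fin.forall_fin_succ, Fin.forall_fin_succ, Fin.forall_fin_succ,
    Fin.forall_fin_one]
  show _ ↔ ((ofBox7 t 0).1.val ≤ pm (ofBox7 t) 0 ∧ (ofBox7 t 1).1.val ≤ pm (ofBox7 t) 1 ∧ (ofBox7 t 2).1.val ≤ pm (ofBox7 t) 2 ∧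
    (ofBox7 t 3).1.val ≤ pm (ofBox7 t) 3 ∧ (ofBox7 t 4).1.val ≤ pm (ofBox7 t) 4 ∧ (ofBox7 t 5).1.val ≤ pm (ofBox7 t) 5 ∧
    (ofBox7 t 6).1.val ≤ pm (ofBox7 t) 6)
  rw [e0, e1, e2, e3, e4, e5, e6, p0, p1, p2, p3, p4, p5, p6]
  simp only [canonB7, canonR7, canonR, q0, q1, q2, q3, q4, q5, q6, Bool.and_eq_true, beq_iff_eq, Nat.ble_eq, Nat.le_zero, and_assoc]

/-- The canonical box tuples: restricted growth, decided on the raw projections. [cite: MadrasSlade1993, Definition 1.2.4] -/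
def boxT7 : Finset Box7 := Finset.univ.filter fun t => canonB7 t = true

/-- Membership in `boxT7` is restricted growth of the word. [cite: MadrasSlade1993, Definition 1.2.4] -/
theorem mem_boxT7 (t : Box7) : t ∈ boxT7 ↔ GrowthOK (ofBox7 t) := by
  rw [boxT7, Finset.mem_filter, canonB7_iff]
  exact ⟨fun h => h.2, fun h => ⟨Finset.mem_univ _, h⟩⟩

/-- The transversal of length 7 (one canonical word per axis type; 112 256 of them). [cite: MadrasSlade1993, Definition 1.2.4] -/
def T7 : Finset (Word 7 7) := boxT7.map ⟨ofBox7, ofBox7_injective⟩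

/-- Counting inside `T7` = counting canonical box tuples. [cite: MadrasSlade1993, Definition 1.2.4] -/
theorem card_filter_T7 (P : Word 7 7 → Prop) [DecidablePred P] :
    (T7.filter P).card = (boxT7.filter fun t => P (ofBox7 t)).card := by
  rw [T7, Finset.filter_map, Finset.card_map]
  rfl

/-- Every word of `T7` is canonical. [cite: MadrasSlade1993, Definition 1.2.4] -/
theorem canon_T7 : ∀ τ ∈ T7, canon τ = τ := by
  intro τ hτ
  obtain ⟨t, ht, rfl⟩ := Finset.mem_map.1 hτ
  exact (growthOK_iff_canon_eq _).1 ((mem_boxT7 t).1 ht)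

/-- The box tuple of the canonical representative of a word of length 7. [cite: MadrasSlade1993, Definition 1.2.4] -/
def boxOf7 {d : ℕ} (u : Word 7 d) : Box7 :=
  ((⟨rank u 0, Nat.lt_succ_of_le (rank_le_pos u 0)⟩, (u 0).2),
    (⟨rank u 1, Nat.lt_succ_of_le (rank_le_pos u 1)⟩, (u 1).2),
    (⟨rank u 2, Nat.lt_succ_of_le (rank_le_pos u 2)⟩, (u 2).2),
    (⟨rank u 3, Nat.lt_succ_of_le (rank_le_pos u 3)⟩, (u 3).2),
    (⟨rank u 4, Nat.lt_succ_of_le (rank_le_pos u 4)⟩, (u 4).2),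
    (⟨rank u 5, Nat.lt_succ_of_le (rank_le_pos u 5)⟩, (u 5).2),
    (⟨rank u 6, Nat.lt_succ_of_le (rank_le_pos u 6)⟩, (u 6).2))

/-- `ofBox7 (boxOf7 u) = canon u`. [cite: MadrasSlade1993, Definition 1.2.4] -/
theorem ofBox7_boxOf7 {d : ℕ} (u : Word 7 d) : ofBox7 (boxOf7 u) = canon u := by
  funext p
  fin_cases p <;> exact Prod.ext (Fin.ext rfl) rfl

/-- ★ COMPLETENESS: the canonical representative of every word of length 7 lies in `T7`. [cite: MadrasSlade1993, Definition 1.2.4] -/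
theorem canon_mem_T7 {d : ℕ} (u : Word 7 d) : canon u ∈ T7 := by
  rw [T7, Finset.mem_map]
  refine ⟨boxOf7 u, (mem_boxT7 _).2 ?_, ofBox7_boxOf7 u⟩
  rw [ofBox7_boxOf7]
  exact (axFixed_canon u).growthOK

/-- ★ The classes of `T7` exhaust `Word 7 d`: total size `(2d)⁷` — derived from completeness and canonicity, no enumeration.
[cite: MadrasSlade1993, Definition 1.2.4] -/
theorem count_T7 (d : ℕ) : ∑ τ ∈ T7, d.descFactorial (numAxes τ) = (2 * d) ^ 7 := by
  classical
  have hdisj : (T7 : Set (Word 7 7)).PairwiseDisjoint fun τ => Finset.univ.filter fun u : Word 7 d => SameType u τ := by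
    intro τ hτ τ' hτ' hne
    refine Finset.disjoint_left.2 fun u hu hu' => hne ?_
    have h1 : SameType u τ := (Finset.mem_filter.1 hu).2
    have h2 : SameType u τ' := (Finset.mem_filter.1 hu').2
    rw [← canon_T7 τ hτ, ← canon_T7 τ' hτ']
    exact (h1.symm.trans h2).canon_eq
  have hunion : T7.biUnion (fun τ => Finset.univ.filter fun u : Word 7 d => SameType u τ) = Finset.univ := by
    apply Finset.eq_univ_of_forall
    intro u
    rw [Finset.mem_biUnion]
    exact ⟨canon u, canon_mem_T7 u, Finset.mem_filter.2 ⟨Finset.mem_univ _, sameType_canon u⟩⟩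
  have := congrArg Finset.card hunion
  rw [Finset.card_biUnion hdisj, Finset.card_univ, card_word] at this
  rw [← this]
  exact Finset.sum_congr rfl fun τ _ => (card_filter_sameType τ d).symm

/-- ★ MASTER FORMULA AT LENGTH 7: a type-invariant count over `Word 7 d` is `Σ_{τ ∈ T7} [Q₀ τ] · d^{(numAxes τ)}`.
[cite: MadrasSlade1993, Definition 1.2.4] -/
theorem card_filter_eq_sum_T7 {d : ℕ} (Q : Word 7 d → Prop) [DecidablePred Q] (Q₀ : Word 7 7 → Prop) [DecidablePred Q₀]
    (hQ : ∀ u : Word 7 d, Q u ↔ Q₀ (canon u)) :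
    (Finset.univ.filter Q).card = ∑ τ ∈ T7, if Q₀ τ then d.descFactorial (numAxes τ) else 0 :=
  card_filter_eq_sum_transversal T7 canon_T7 (count_T7 d) Q Q₀ hQ

/-! ### The number of axes on canonical tuples -/

/-- `1 + max axis` of a box tuple (raw). [cite: MadrasSlade1993, Definition 1.2.4] -/
def nax7 (t : Box7) : ℕ :=
  (t.1.1.val ⊔ (t.2.1.1.val ⊔ (t.2.2.1.1.val ⊔ (t.2.2.2.1.1.val ⊔ (t.2.2.2.2.1.1.val ⊔ (t.2.2.2.2.2.1.1.val ⊔ t.2.2.2.2.2.2.1.val)))))) + 1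

/-- ★ On canonical tuples, the raw `nax7` is the number of axes of the word. [cite: MadrasSlade1993, Definition 1.2.4] -/
theorem nax7_eq_numAxes (t : Box7) (ht : t ∈ boxT7) : nax7 t = numAxes (ofBox7 t) := by
  have hfix : AxFixed (ofBox7 t) := ((mem_boxT7 t).1 ht).axFixed
  rw [numAxes_eq_sup_succ _ hfix (by norm_num), nax7]
  have e : (Finset.univ : Finset (Fin 7)) = {0, 1, 2, 3, 4, 5, 6} := by decide
  rw [e]
  simp only [Finset.sup_insert, Finset.sup_singleton]
  simp [ofBox7]

/-- `1 + max axis` on seven raw letters. [cite: MadrasSlade1993, Definition 1.2.4] -/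
def naxR7 (a b c e f g h : ℕ × Bool) : ℕ := (a.1 ⊔ (b.1 ⊔ (c.1 ⊔ (e.1 ⊔ (f.1 ⊔ (g.1 ⊔ h.1)))))) + 1

/-- `naxR7` on the raw letters of a box tuple is `nax7`. [cite: MadrasSlade1993, Definition 1.2.4] -/
theorem naxR7_eq (t : Box7) : naxR7 (q0 t) (q1 t) (q2 t) (q3 t) (q4 t) (q5 t) (q6 t) = nax7 t := rfl

/-! ### Split scalar cells and histogram cells (ROBUST form: nested `List.foldr` over raw letters)

A class is given to the kernel as a raw Boolean test `g` on seven raw letters; its meaning on box tuples is `g (q0 t) ⋯ (q6 t)`.  The scalar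
cell `cnt7 g k a₆` counts the canonical tuples of the class with `k` axes and LAST raw letter `a₆` (a fold over the first six letters, the
shape of `…SixBlocks.cnt`); the histogram cell `cntH g a₆` computes all eight `cnt7 g k a₆`, `k = 0, …, 7`, in ONE pass. -/

/-- The raw letters of axis `< 7`. [cite: MadrasSlade1993, Definition 1.2.4] -/
def letters7 : List (ℕ × Bool) := letters 7

/-- Summing `f ∘ raw` over `Fin 7 × Bool` = folding `f` over `letters7`. [cite: MadrasSlade1993, Definition 1.2.4] -/
theorem sum_eq_foldr_letters7 (f : ℕ × Bool → ℕ) :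
    ∑ a : Fin 7 × Bool, f (a.1.val, a.2) = letters7.foldr (fun r acc => acc + f r) 0 := by
  rw [foldr_add_eq_sum]
  have hl : letters7 = (lettersF 7).map fun a => (a.1.val, a.2) := by decide
  have hnd : (lettersF 7).Nodup := by decide
  have huniv : (lettersF 7).toFinset = Finset.univ := by decide
  rw [hl, List.map_map, ← huniv, List.sum_toFinset _ hnd]
  rfl

/-- The raw leaf test of a split cell: canonical, in the class, `k` axes. [cite: MadrasSlade1993, Definition 1.2.4] -/
def leaf7 (g : ℕ × Bool → ℕ × Bool → ℕ × Bool → ℕ × Bool → ℕ × Bool → ℕ × Bool → ℕ × Bool → Bool) (k : ℕ)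
    (a b c e f g' h : ℕ × Bool) : Bool :=
  canonR7 a b c e f g' h && g a b c e f g' h && (naxR7 a b c e f g' h == k)

/-- The leaf test decides `canonical ∧ class ∧ nax7 = k`. [cite: MadrasSlade1993, Definition 1.2.4] -/
theorem leaf7_iff (g : ℕ × Bool → ℕ × Bool → ℕ × Bool → ℕ × Bool → ℕ × Bool → ℕ × Bool → ℕ × Bool → Bool) (k : ℕ) (t : Box7) :
    leaf7 g k (q0 t) (q1 t) (q2 t) (q3 t) (q4 t) (q5 t) (q6 t) = true ↔
      canonB7 t = true ∧ g (q0 t) (q1 t) (q2 t) (q3 t) (q4 t) (q5 t) (q6 t) = true ∧ nax7 t = k := by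
  rw [leaf7, Bool.and_eq_true, Bool.and_eq_true, beq_iff_eq, naxR7_eq, and_assoc]
  rfl

/-- The split scalar cell: canonical tuples of the class `g` with `k` axes and last raw letter `a₆`, as a nested fold over the first six
letters (recursion depth ≤ 6·12). [cite: MadrasSlade1993, Definition 1.2.4] -/
def cnt7 (g : ℕ × Bool → ℕ × Bool → ℕ × Bool → ℕ × Bool → ℕ × Bool → ℕ × Bool → ℕ × Bool → Bool) (k : ℕ) (a6 : ℕ × Bool) : ℕ :=
  (letters 1).foldr (fun a0 acc0 => acc0 + (letters 2).foldr (fun a1 acc1 => acc1 + (letters 3).foldr (fun a2 acc2 => acc2 +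
    (letters 4).foldr (fun a3 acc3 => acc3 + (letters 5).foldr (fun a4 acc4 => acc4 + (letters 6).foldr (fun a5 acc5 => acc5 +
      (if leaf7 g k a0 a1 a2 a3 a4 a5 a6 = true then 1 else 0)) 0) 0) 0) 0) 0) 0

/-- The box with its last letter split off. [cite: MadrasSlade1993, Definition 1.2.4] -/
def split7 : Box7 ≃ Box6 × (Fin 7 × Bool) where
  toFun t := ((t.1, t.2.1, t.2.2.1, t.2.2.2.1, t.2.2.2.2.1, t.2.2.2.2.2.1), t.2.2.2.2.2.2)
  invFun p := (p.1.1, p.1.2.1, p.1.2.2.1, p.1.2.2.2.1, p.1.2.2.2.2.1, p.1.2.2.2.2.2, p.2)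
  left_inv _ := rfl
  right_inv _ := rfl

/-- ★ The split cells summed over the last letter ARE the `Finset` count over the canonical box. [cite: MadrasSlade1993, Definition 1.2.4] -/
theorem sum_cnt7_eq_card (g : ℕ × Bool → ℕ × Bool → ℕ × Bool → ℕ × Bool → ℕ × Bool → ℕ × Bool → ℕ × Bool → Bool) (k : ℕ) :
    letters7.foldr (fun a6 acc => acc + cnt7 g k a6) 0 =
      (boxT7.filter fun t => g (q0 t) (q1 t) (q2 t) (q3 t) (q4 t) (q5 t) (q6 t) = true ∧ nax7 t = k).card := by
  rw [boxT7, Finset.filter_filter, Finset.card_filter]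
  have hleaf : ∀ t : Box7, (if canonB7 t = true ∧ g (q0 t) (q1 t) (q2 t) (q3 t) (q4 t) (q5 t) (q6 t) = true ∧ nax7 t = k then 1 else 0) =
      (if leaf7 g k (t.1.1.val, t.1.2) (t.2.1.1.val, t.2.1.2) (t.2.2.1.1.val, t.2.2.1.2) (t.2.2.2.1.1.val, t.2.2.2.1.2)
        (t.2.2.2.2.1.1.val, t.2.2.2.2.1.2) (t.2.2.2.2.2.1.1.val, t.2.2.2.2.2.1.2) (t.2.2.2.2.2.2.1.val, t.2.2.2.2.2.2.2) = true
        then 1 else 0) :=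
    fun t => if_congr (leaf7_iff g k t).symm rfl rfl
  simp only [hleaf]
  -- reorder: the last letter outermost
  rw [← Equiv.sum_comp split7.symm]
  dsimp only [split7, Equiv.coe_fn_symm_mk]
  rw [Fintype.sum_prod_type_right]
  dsimp only
  refine Eq.trans ?_ (sum_eq_foldr_letters7 (fun r6 => ∑ x : Box6, if leaf7 g k (x.1.1.val, x.1.2) (x.2.1.1.val, x.2.1.2)
    (x.2.2.1.1.val, x.2.2.1.2) (x.2.2.2.1.1.val, x.2.2.2.1.2) (x.2.2.2.2.1.1.val, x.2.2.2.2.1.2) (x.2.2.2.2.2.1.val, x.2.2.2.2.2.2) r6 =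
    true then 1 else 0)).symm
  refine congrArg (fun G => letters7.foldr G 0) (funext fun r6 => funext fun acc => congrArg (acc + ·) ?_)
  unfold cnt7
  rw [Fintype.sum_prod_type, sum_eq_foldr_letters (by norm_num) (fun r0 => ∑ y : (Fin 2 × Bool) × (Fin 3 × Bool) × (Fin 4 × Bool) ×
    (Fin 5 × Bool) × (Fin 6 × Bool), if leaf7 g k r0 (y.1.1.val, y.1.2) (y.2.1.1.val, y.2.1.2) (y.2.2.1.1.val, y.2.2.1.2)
      (y.2.2.2.1.1.val, y.2.2.2.1.2) (y.2.2.2.2.1.val, y.2.2.2.2.2) r6 = true then 1 else 0)]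
  refine congrArg (fun G => (letters 1).foldr G 0) (funext fun r0 => funext fun acc0 => congrArg (acc0 + ·) ?_)
  rw [Fintype.sum_prod_type, sum_eq_foldr_letters (by norm_num) (fun r1 => ∑ y : (Fin 3 × Bool) × (Fin 4 × Bool) × (Fin 5 × Bool) ×
    (Fin 6 × Bool), if leaf7 g k r0 r1 (y.1.1.val, y.1.2) (y.2.1.1.val, y.2.1.2) (y.2.2.1.1.val, y.2.2.1.2)
      (y.2.2.2.1.val, y.2.2.2.2) r6 = true then 1 else 0)]
  refine congrArg (fun G => (letters 2).foldr G 0) (funext fun r1 => funext fun acc1 => congrArg (acc1 + ·) ?_)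
  rw [Fintype.sum_prod_type, sum_eq_foldr_letters (by norm_num) (fun r2 => ∑ y : (Fin 4 × Bool) × (Fin 5 × Bool) × (Fin 6 × Bool),
    if leaf7 g k r0 r1 r2 (y.1.1.val, y.1.2) (y.2.1.1.val, y.2.1.2) (y.2.2.1.val, y.2.2.2) r6 = true then 1 else 0)]
  refine congrArg (fun G => (letters 3).foldr G 0) (funext fun r2 => funext fun acc2 => congrArg (acc2 + ·) ?_)
  rw [Fintype.sum_prod_type, sum_eq_foldr_letters (by norm_num) (fun r3 => ∑ y : (Fin 5 × Bool) × (Fin 6 × Bool),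
    if leaf7 g k r0 r1 r2 r3 (y.1.1.val, y.1.2) (y.2.1.val, y.2.2) r6 = true then 1 else 0)]
  refine congrArg (fun G => (letters 4).foldr G 0) (funext fun r3 => funext fun acc3 => congrArg (acc3 + ·) ?_)
  rw [Fintype.sum_prod_type, sum_eq_foldr_letters (by norm_num) (fun r4 => ∑ y : Fin 6 × Bool,
    if leaf7 g k r0 r1 r2 r3 r4 (y.1.val, y.2) r6 = true then 1 else 0)]
  refine congrArg (fun G => (letters 5).foldr G 0) (funext fun r4 => funext fun acc4 => congrArg (acc4 + ·) ?_)
  rw [sum_eq_foldr_letters (by norm_num) (fun r5 => if leaf7 g k r0 r1 r2 r3 r4 r5 r6 = true then 1 else 0)]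

/-- ★ TRANSPORT OF THE SPLIT CELLS to `T7` with a genuine class predicate `G` and `numAxes`. [cite: MadrasSlade1993, Definition 1.2.4] -/
theorem card_T7_class (g : ℕ × Bool → ℕ × Bool → ℕ × Bool → ℕ × Bool → ℕ × Bool → ℕ × Bool → ℕ × Bool → Bool)
    (G : Word 7 7 → Prop) [DecidablePred G] (hg : ∀ t : Box7, g (q0 t) (q1 t) (q2 t) (q3 t) (q4 t) (q5 t) (q6 t) = true ↔ G (ofBox7 t))
    (k : ℕ) : ((T7.filter G).filter fun τ => numAxes τ = k).card = letters7.foldr (fun a6 acc => acc + cnt7 g k a6) 0 := by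
  rw [Finset.filter_filter, card_filter_T7, sum_cnt7_eq_card]
  refine congrArg Finset.card (Finset.filter_congr fun t ht => ?_)
  rw [← hg t, nax7_eq_numAxes t ht]

/-- ★ THE CENSUS OF A CLASS AT LENGTH 7 from its split cells: if `Q` (on `Word 7 d`) is the type-invariant class with canonical form `G`,
decided on raw letters by `g`, and the split cells sum to `n k` for every `k ≤ 7`, then `#{u : Word 7 d | Q u} = Σ_{k ≤ 7} n k · d^{(k)}`
for every `d`. [cite: MadrasSlade1993, Definition 1.2.4] -/
theorem card_good7_eq {d : ℕ} (Q : Word 7 d → Prop) [DecidablePred Q] (G : Word 7 7 → Prop) [DecidablePred G]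
    (hQ : ∀ u : Word 7 d, Q u ↔ G (canon u))
    (g : ℕ × Bool → ℕ × Bool → ℕ × Bool → ℕ × Bool → ℕ × Bool → ℕ × Bool → ℕ × Bool → Bool)
    (hg : ∀ t : Box7, g (q0 t) (q1 t) (q2 t) (q3 t) (q4 t) (q5 t) (q6 t) = true ↔ G (ofBox7 t)) (n : ℕ → ℕ)
    (hn : ∀ k, k < 8 → letters7.foldr (fun a6 acc => acc + cnt7 g k a6) 0 = n k) :
    (Finset.univ.filter Q).card = ∑ k ∈ Finset.range 8, n k * d.descFactorial k := by
  rw [card_filter_eq_sum_T7 Q G hQ, sum_ite_descFactorial_numAxes]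
  exact Finset.sum_congr rfl fun k hk => by rw [card_T7_class g G hg, hn k (Finset.mem_range.1 hk)]

/-! ### Histogram cells: all eight split cells of a class and a last letter in ONE kernel pass -/

/-- Increment entry `i` of a histogram (no-op beyond its length). [cite: MadrasSlade1993, Definition 1.2.4] -/
def bump (h : List ℕ) (i : ℕ) : List ℕ := h.modify i (· + 1)

/-- `bump` preserves the length. [cite: MadrasSlade1993, Definition 1.2.4] -/
theorem length_bump (h : List ℕ) (i : ℕ) : (bump h i).length = h.length := by
  simp [bump]

/-- Entry `k` of `bump h i` (for `k` inside the histogram). [cite: MadrasSlade1993, Definition 1.2.4] -/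
theorem getD_bump (h : List ℕ) (i k : ℕ) (hk : k < h.length) :
    (bump h i).getD k 0 = h.getD k 0 + if i = k then 1 else 0 := by
  simp only [bump, List.getD_eq_getElem?_getD, List.getElem?_modify]
  by_cases hik : i = k
  · subst hik
    simp [List.getElem?_eq_getElem hk]
  · simp [hik]

/-- One step of the histogram pass: a canonical tuple of the class bumps the entry `naxR7`. [cite: MadrasSlade1993, Definition 1.2.4] -/
def step7 (g : ℕ × Bool → ℕ × Bool → ℕ × Bool → ℕ × Bool → ℕ × Bool → ℕ × Bool → ℕ × Bool → Bool)
    (a b c e f g' a6 : ℕ × Bool) (h : List ℕ) : List ℕ :=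
  if (canonR7 a b c e f g' a6 && g a b c e f g' a6) = true then bump h (naxR7 a b c e f g' a6) else h

/-- `step7` preserves the length. [cite: MadrasSlade1993, Definition 1.2.4] -/
theorem length_step7 (g : ℕ × Bool → ℕ × Bool → ℕ × Bool → ℕ × Bool → ℕ × Bool → ℕ × Bool → ℕ × Bool → Bool)
    (a b c e f g' a6 : ℕ × Bool) (h : List ℕ) : (step7 g a b c e f g' a6 h).length = h.length := by
  unfold step7
  split_ifs
  · exact length_bump _ _
  · rfl

/-- Entry `k` after one step = before + the scalar leaf. [cite: MadrasSlade1993, Definition 1.2.4] -/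
theorem getD_step7 (g : ℕ × Bool → ℕ × Bool → ℕ × Bool → ℕ × Bool → ℕ × Bool → ℕ × Bool → ℕ × Bool → Bool)
    (a b c e f g' a6 : ℕ × Bool) (h : List ℕ) (k : ℕ) (hk : k < h.length) :
    (step7 g a b c e f g' a6 h).getD k 0 = h.getD k 0 + if leaf7 g k a b c e f g' a6 = true then 1 else 0 := by
  unfold step7 leaf7
  by_cases hc : (canonR7 a b c e f g' a6 && g a b c e f g' a6) = true
  · rw [if_pos hc, getD_bump h _ k hk]
    congr 1
    apply if_congr _ rfl rfl
    rw [Bool.and_eq_true, beq_iff_eq]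
    exact ⟨fun h1 => ⟨hc, h1⟩, fun h1 => h1.2⟩
  · rw [if_neg hc, if_neg]
    · rfl
    · rw [Bool.and_eq_true]
      exact fun h1 => hc h1.1

/-- A fold of length-preserving updates preserves the length. [cite: MadrasSlade1993, Definition 1.2.4] -/
theorem length_foldr_of_length {α : Type*} (l : List α) (upd : α → List ℕ → List ℕ)
    (hlen : ∀ a h, (upd a h).length = h.length) (init : List ℕ) : (l.foldr upd init).length = init.length := by
  induction l with
  | nil => rfl
  | cons a l ih => rw [List.foldr_cons, hlen, ih]

/-- Entry `k` of a fold of additive updates = entry `k` of the start + the scalar fold of the increments.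
[cite: MadrasSlade1993, Definition 1.2.4] -/
theorem getD_foldr_of_getD {α : Type*} (l : List α) (upd : α → List ℕ → List ℕ) (w : α → ℕ) (k : ℕ)
    (hlen : ∀ a h, (upd a h).length = h.length) (hget : ∀ a h, k < h.length → (upd a h).getD k 0 = h.getD k 0 + w a)
    (init : List ℕ) (hk : k < init.length) :
    (l.foldr upd init).getD k 0 = init.getD k 0 + l.foldr (fun a s => s + w a) 0 := by
  induction l with
  | nil => simp
  | cons a l ih =>
    rw [List.foldr_cons, List.foldr_cons, hget a _ (by rw [length_foldr_of_length l upd hlen init]; exact hk), ih]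
    ring

/-- The histogram cell: the eight split cells `cnt7 g k a₆`, `k = 0, …, 7`, in one pass (threaded histogram of length 8).
[cite: MadrasSlade1993, Definition 1.2.4] -/
def cntH (g : ℕ × Bool → ℕ × Bool → ℕ × Bool → ℕ × Bool → ℕ × Bool → ℕ × Bool → ℕ × Bool → Bool) (a6 : ℕ × Bool) : List ℕ :=
  (letters 1).foldr (fun a0 h0 => (letters 2).foldr (fun a1 h1 => (letters 3).foldr (fun a2 h2 => (letters 4).foldr (fun a3 h3 =>
    (letters 5).foldr (fun a4 h4 => (letters 6).foldr (fun a5 h5 => step7 g a0 a1 a2 a3 a4 a5 a6 h5) h4) h3) h2) h1) h0)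
    (List.replicate 8 0)

/-- ★ Entry `k` of the histogram cell IS the split scalar cell (`k ≤ 7`). [cite: MadrasSlade1993, Definition 1.2.4] -/
theorem getD_cntH (g : ℕ × Bool → ℕ × Bool → ℕ × Bool → ℕ × Bool → ℕ × Bool → ℕ × Bool → ℕ × Bool → Bool) (a6 : ℕ × Bool)
    {k : ℕ} (hk : k < 8) : (cntH g a6).getD k 0 = cnt7 g k a6 := by
  -- lengths, level by level (innermost first)
  have L5 : ∀ a0 a1 a2 a3 a4 h, ((letters 6).foldr (fun a5 h5 => step7 g a0 a1 a2 a3 a4 a5 a6 h5) h).length = h.length :=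
    fun a0 a1 a2 a3 a4 h => length_foldr_of_length _ _ (fun a5 h5 => length_step7 g a0 a1 a2 a3 a4 a5 a6 h5) h
  have L4 : ∀ a0 a1 a2 a3 h, ((letters 5).foldr (fun a4 h4 => (letters 6).foldr (fun a5 h5 => step7 g a0 a1 a2 a3 a4 a5 a6 h5) h4)
      h).length = h.length := fun a0 a1 a2 a3 h => length_foldr_of_length _ _ (fun a4 h4 => L5 a0 a1 a2 a3 a4 h4) h
  have L3 : ∀ a0 a1 a2 h, ((letters 4).foldr (fun a3 h3 => (letters 5).foldr (fun a4 h4 => (letters 6).foldr (fun a5 h5 =>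
      step7 g a0 a1 a2 a3 a4 a5 a6 h5) h4) h3) h).length = h.length :=
    fun a0 a1 a2 h => length_foldr_of_length _ _ (fun a3 h3 => L4 a0 a1 a2 a3 h3) h
  have L2 : ∀ a0 a1 h, ((letters 3).foldr (fun a2 h2 => (letters 4).foldr (fun a3 h3 => (letters 5).foldr (fun a4 h4 =>
      (letters 6).foldr (fun a5 h5 => step7 g a0 a1 a2 a3 a4 a5 a6 h5) h4) h3) h2) h).length = h.length :=
    fun a0 a1 h => length_foldr_of_length _ _ (fun a2 h2 => L3 a0 a1 a2 h2) h
  have L1 : ∀ a0 h, ((letters 2).foldr (fun a1 h1 => (letters 3).foldr (fun a2 h2 => (letters 4).foldr (fun a3 h3 =>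
      (letters 5).foldr (fun a4 h4 => (letters 6).foldr (fun a5 h5 => step7 g a0 a1 a2 a3 a4 a5 a6 h5) h4) h3) h2) h1) h).length =
      h.length := fun a0 h => length_foldr_of_length _ _ (fun a1 h1 => L2 a0 a1 h1) h
  -- entries, level by level (innermost first)
  have G5 : ∀ a0 a1 a2 a3 a4 h, k < h.length → ((letters 6).foldr (fun a5 h5 => step7 g a0 a1 a2 a3 a4 a5 a6 h5) h).getD k 0 =
      h.getD k 0 + (letters 6).foldr (fun a5 s => s + if leaf7 g k a0 a1 a2 a3 a4 a5 a6 = true then 1 else 0) 0 :=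
    fun a0 a1 a2 a3 a4 h hh => getD_foldr_of_getD _ _ _ k (fun a5 h5 => length_step7 g a0 a1 a2 a3 a4 a5 a6 h5)
      (fun a5 h5 hh5 => getD_step7 g a0 a1 a2 a3 a4 a5 a6 h5 k hh5) h hh
  have G4 : ∀ a0 a1 a2 a3 h, k < h.length → ((letters 5).foldr (fun a4 h4 => (letters 6).foldr (fun a5 h5 =>
      step7 g a0 a1 a2 a3 a4 a5 a6 h5) h4) h).getD k 0 = h.getD k 0 + (letters 5).foldr (fun a4 s => s + (letters 6).foldr
      (fun a5 s => s + if leaf7 g k a0 a1 a2 a3 a4 a5 a6 = true then 1 else 0) 0) 0 :=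
    fun a0 a1 a2 a3 h hh => getD_foldr_of_getD _ _ _ k (fun a4 h4 => L5 a0 a1 a2 a3 a4 h4) (fun a4 h4 hh4 => G5 a0 a1 a2 a3 a4 h4 hh4) h hh
  have G3 : ∀ a0 a1 a2 h, k < h.length → ((letters 4).foldr (fun a3 h3 => (letters 5).foldr (fun a4 h4 => (letters 6).foldr
      (fun a5 h5 => step7 g a0 a1 a2 a3 a4 a5 a6 h5) h4) h3) h).getD k 0 = h.getD k 0 + (letters 4).foldr (fun a3 s => s +
      (letters 5).foldr (fun a4 s => s + (letters 6).foldr (fun a5 s => s + if leaf7 g k a0 a1 a2 a3 a4 a5 a6 = true then 1 else 0)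
      0) 0) 0 :=
    fun a0 a1 a2 h hh => getD_foldr_of_getD _ _ _ k (fun a3 h3 => L4 a0 a1 a2 a3 h3) (fun a3 h3 hh3 => G4 a0 a1 a2 a3 h3 hh3) h hh
  have G2 : ∀ a0 a1 h, k < h.length → ((letters 3).foldr (fun a2 h2 => (letters 4).foldr (fun a3 h3 => (letters 5).foldr (fun a4 h4 =>
      (letters 6).foldr (fun a5 h5 => step7 g a0 a1 a2 a3 a4 a5 a6 h5) h4) h3) h2) h).getD k 0 = h.getD k 0 + (letters 3).foldr
      (fun a2 s => s + (letters 4).foldr (fun a3 s => s + (letters 5).foldr (fun a4 s => s + (letters 6).foldr (fun a5 s => s +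
      if leaf7 g k a0 a1 a2 a3 a4 a5 a6 = true then 1 else 0) 0) 0) 0) 0 :=
    fun a0 a1 h hh => getD_foldr_of_getD _ _ _ k (fun a2 h2 => L3 a0 a1 a2 h2) (fun a2 h2 hh2 => G3 a0 a1 a2 h2 hh2) h hh
  have G1 : ∀ a0 h, k < h.length → ((letters 2).foldr (fun a1 h1 => (letters 3).foldr (fun a2 h2 => (letters 4).foldr (fun a3 h3 =>
      (letters 5).foldr (fun a4 h4 => (letters 6).foldr (fun a5 h5 => step7 g a0 a1 a2 a3 a4 a5 a6 h5) h4) h3) h2) h1) h).getD k 0 =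
      h.getD k 0 + (letters 2).foldr (fun a1 s => s + (letters 3).foldr (fun a2 s => s + (letters 4).foldr (fun a3 s => s +
      (letters 5).foldr (fun a4 s => s + (letters 6).foldr (fun a5 s => s + if leaf7 g k a0 a1 a2 a3 a4 a5 a6 = true then 1 else 0)
      0) 0) 0) 0) 0 :=
    fun a0 h hh => getD_foldr_of_getD _ _ _ k (fun a1 h1 => L2 a0 a1 h1) (fun a1 h1 hh1 => G2 a0 a1 h1 hh1) h hh
  have G0 := getD_foldr_of_getD (letters 1) _ _ k (fun a0 h0 => L1 a0 h0) (fun a0 h0 hh0 => G1 a0 h0 hh0) (List.replicate 8 0)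
    (by simpa using hk)
  unfold cntH cnt7
  rw [G0, List.getD_eq_getElem?_getD, List.getElem?_replicate, if_pos hk, Option.getD_some, zero_add]

/-- `letters7` spelled out. [cite: MadrasSlade1993, Definition 1.2.4] -/
theorem letters7_eq : letters7 = [(0, true), (0, false), (1, true), (1, false), (2, true), (2, false), (3, true), (3, false),
    (4, true), (4, false), (5, true), (5, false), (6, true), (6, false)] := by decide

/-- Congruence of the additive scalar fold along membership. [cite: MadrasSlade1993, Definition 1.2.4] -/
theorem foldr_add_congr {α : Type*} (l : List α) (f f' : α → ℕ) (h : ∀ a ∈ l, f a = f' a) :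
    l.foldr (fun a acc => acc + f a) 0 = l.foldr (fun a acc => acc + f' a) 0 := by
  induction l with
  | nil => rfl
  | cons a l ih =>
    rw [List.foldr_cons, List.foldr_cons, h a (by simp), ih fun b hb => h b (by simp [hb])]

/-- ★ FROM HISTOGRAM CELLS TO THE TOTALS: if the fourteen histogram cells of the class `g` are `L a₆`, then for `k ≤ 7` the split
cells sum to `Σ_{a₆} (L a₆)_k` — a closed numeral once `L` is a table. [cite: MadrasSlade1993, Definition 1.2.4] -/
theorem total7_eq (g : ℕ × Bool → ℕ × Bool → ℕ × Bool → ℕ × Bool → ℕ × Bool → ℕ × Bool → ℕ × Bool → Bool)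
    (L : ℕ × Bool → List ℕ) (hcell : ∀ a6 ∈ letters7, cntH g a6 = L a6) {k : ℕ} (hk : k < 8) :
    letters7.foldr (fun a6 acc => acc + cnt7 g k a6) 0 = letters7.foldr (fun a6 acc => acc + (L a6).getD k 0) 0 :=
  foldr_add_congr _ _ _ fun a6 ha6 => by rw [← getD_cntH g a6 hk, hcell a6 ha6]

/-! ### The classes of «ZD-NINE-STEP»: seven-step self-avoiding words with a closing tail

A seven-letter transverse word is the word of a seven-step self-avoiding walk iff its twelve even blocks are non-zero (`SAW7`); the
one-step extensions that CLOSE a square / hexagon / octagon are those whose last three / five / seven letters sum to a unit vector,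
i.e. some one of them is left over while the others cancel (`UnitTail3/5/7`).  Word-level predicates are `Finset` sums (type-invariant
by `SameType.sum_eq_zero_iff`); the raw tests `saw7R`, `unit3R`, `unit5R`, `unit7R` decide them on box tuples. -/

section classes

variable {n : ℕ}

/-- The block of positions `[i, j)` in a word of length 7. [cite: MadrasSlade1993, Definition 1.2.4] -/
def blk7 (i j : ℕ) : Finset (Fin 7) := Finset.univ.filter fun p => i ≤ p.val ∧ p.val < j

/-- The block sum of a word of length 7. [cite: MadrasSlade1993, Definition 1.2.4] -/
noncomputable def bsum7 (u : Word 7 n) (i j : ℕ) : Site (n + 1) := ∑ p ∈ blk7 i j, twoStepV n (u p)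

/-- The sum of the block `[i, 7)` with the position `p` left out. [cite: MadrasSlade1993, Definition 1.2.4] -/
noncomputable def esum7 (u : Word 7 n) (i : ℕ) (p : Fin 7) : Site (n + 1) := ∑ q ∈ (blk7 i 7).erase p, twoStepV n (u q)

/-- A seven-step self-avoiding word: the twelve even blocks are non-zero. [cite: MadrasSlade1993, §4.2, remark after Theorem 4.2.4 (p. 94)] -/
abbrev SAW7 (u : Word 7 n) : Prop :=
  bsum7 u 0 2 ≠ 0 ∧ bsum7 u 1 3 ≠ 0 ∧ bsum7 u 2 4 ≠ 0 ∧ bsum7 u 3 5 ≠ 0 ∧ bsum7 u 4 6 ≠ 0 ∧ bsum7 u 5 7 ≠ 0 ∧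
    bsum7 u 0 4 ≠ 0 ∧ bsum7 u 1 5 ≠ 0 ∧ bsum7 u 2 6 ≠ 0 ∧ bsum7 u 3 7 ≠ 0 ∧ bsum7 u 0 6 ≠ 0 ∧ bsum7 u 1 7 ≠ 0

/-- The last three letters sum to a unit vector: one of them left out, the other two cancel. [cite: MadrasSlade1993, §4.2, remark after Theorem 4.2.4 (p. 94)] -/
abbrev UnitTail3 (u : Word 7 n) : Prop := esum7 u 4 4 = 0 ∨ esum7 u 4 5 = 0 ∨ esum7 u 4 6 = 0

/-- The last five letters sum to a unit vector: one of them left out, the other four cancel. [cite: MadrasSlade1993, §4.2, remark after Theorem 4.2.4 (p. 94)] -/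
abbrev UnitTail5 (u : Word 7 n) : Prop := esum7 u 2 2 = 0 ∨ esum7 u 2 3 = 0 ∨ esum7 u 2 4 = 0 ∨ esum7 u 2 5 = 0 ∨ esum7 u 2 6 = 0

/-- All seven letters sum to a unit vector: one of them left out, the other six cancel. [cite: MadrasSlade1993, §4.2, remark after Theorem 4.2.4 (p. 94)] -/
abbrev UnitTail7 (u : Word 7 n) : Prop :=
  esum7 u 0 0 = 0 ∨ esum7 u 0 1 = 0 ∨ esum7 u 0 2 = 0 ∨ esum7 u 0 3 = 0 ∨ esum7 u 0 4 = 0 ∨ esum7 u 0 5 = 0 ∨ esum7 u 0 6 = 0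

/-- Vanishing of a block sum is a type invariant. [cite: MadrasSlade1993, Definition 1.2.4] -/
theorem bsum7_eq_zero_iff_canon (u : Word 7 n) (i j : ℕ) : bsum7 u i j = 0 ↔ bsum7 (canon u) i j = 0 :=
  (sameType_canon u).sum_eq_zero_iff _

/-- Vanishing of a punctured tail sum is a type invariant. [cite: MadrasSlade1993, Definition 1.2.4] -/
theorem esum7_eq_zero_iff_canon (u : Word 7 n) (i : ℕ) (p : Fin 7) : esum7 u i p = 0 ↔ esum7 (canon u) i p = 0 :=
  (sameType_canon u).sum_eq_zero_iff _

/-- `SAW7` is a type invariant. [cite: MadrasSlade1993, §4.2, remark after Theorem 4.2.4 (p. 94)] -/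
theorem saw7_iff_canon (u : Word 7 n) : SAW7 u ↔ SAW7 (canon u) := by
  unfold SAW7
  simp only [ne_eq, bsum7_eq_zero_iff_canon u]

/-- `UnitTail3` is a type invariant. [cite: MadrasSlade1993, §4.2, remark after Theorem 4.2.4 (p. 94)] -/
theorem unitTail3_iff_canon (u : Word 7 n) : UnitTail3 u ↔ UnitTail3 (canon u) := by
  unfold UnitTail3
  simp only [esum7_eq_zero_iff_canon u]

/-- `UnitTail5` is a type invariant. [cite: MadrasSlade1993, §4.2, remark after Theorem 4.2.4 (p. 94)] -/
theorem unitTail5_iff_canon (u : Word 7 n) : UnitTail5 u ↔ UnitTail5 (canon u) := by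
  unfold UnitTail5
  simp only [esum7_eq_zero_iff_canon u]

/-- `UnitTail7` is a type invariant. [cite: MadrasSlade1993, §4.2, remark after Theorem 4.2.4 (p. 94)] -/
theorem unitTail7_iff_canon (u : Word 7 n) : UnitTail7 u ↔ UnitTail7 (canon u) := by
  unfold UnitTail7
  simp only [esum7_eq_zero_iff_canon u]

/-- The raw SAW test on seven raw letters: the twelve even blocks do not cancel. [cite: MadrasSlade1993, §4.2, remark after Theorem 4.2.4 (p. 94)] -/
def saw7R (a b c e f g h : ℕ × Bool) : Bool :=
  !z2 a b && !z2 b c && !z2 c e && !z2 e f && !z2 f g && !z2 g h &&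
  !z4 a b c e && !z4 b c e f && !z4 c e f g && !z4 e f g h && !z6 a b c e f g && !z6 b c e f g h

/-- Raw test: the last three letters sum to a unit vector. [cite: MadrasSlade1993, §4.2, remark after Theorem 4.2.4 (p. 94)] -/
def unit3R (f g h : ℕ × Bool) : Bool := z2 g h || z2 f h || z2 f g

/-- Raw test: the last five letters sum to a unit vector. [cite: MadrasSlade1993, §4.2, remark after Theorem 4.2.4 (p. 94)] -/
def unit5R (c e f g h : ℕ × Bool) : Bool := z4 e f g h || z4 c f g h || z4 c e g h || z4 c e f h || z4 c e f g

/-- Raw test: all seven letters sum to a unit vector. [cite: MadrasSlade1993, §4.2, remark after Theorem 4.2.4 (p. 94)] -/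
def unit7R (a b c e f g h : ℕ × Bool) : Bool :=
  z6 b c e f g h || z6 a c e f g h || z6 a b e f g h || z6 a b c f g h || z6 a b c e g h || z6 a b c e f h || z6 a b c e f g

/-- Finite sums over an explicitly listed set of positions. [cite: MadrasSlade1993, Definition 1.2.4] -/
theorem sum_eq_list_sum {M : Type*} [AddCommMonoid M] (S : Finset (Fin 7)) (l : List (Fin 7)) (h : S = l.toFinset) (hl : l.Nodup)
    (v : Fin 7 → M) : ∑ q ∈ S, v q = (l.map v).sum := by
  subst h
  rw [List.sum_toFinset _ hl]

/-- ★ The raw tests decide the word-level classes on box tuples: `SAW7`. [cite: MadrasSlade1993, §4.2, remark after Theorem 4.2.4 (p. 94)] -/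
theorem saw7R_iff (t : Box7) : saw7R (q0 t) (q1 t) (q2 t) (q3 t) (q4 t) (q5 t) (q6 t) = true ↔ SAW7 (ofBox7 t) := by
  obtain ⟨r0, r1, r2, r3, r4, r5, r6⟩ := raw_ofBox7 t
  have E : ∀ (i j : ℕ) (l : List (Fin 7)), blk7 i j = l.toFinset → l.Nodup →
      bsum7 (ofBox7 t) i j = (l.map fun q => twoStepV 7 (ofBox7 t q)).sum :=
    fun i j l h hl => sum_eq_list_sum _ l h hl _
  have e02 := E 0 2 [0, 1] (by decide) (by decide)
  have e13 := E 1 3 [1, 2] (by decide) (by decide)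
  have e24 := E 2 4 [2, 3] (by decide) (by decide)
  have e35 := E 3 5 [3, 4] (by decide) (by decide)
  have e46 := E 4 6 [4, 5] (by decide) (by decide)
  have e57 := E 5 7 [5, 6] (by decide) (by decide)
  have e04 := E 0 4 [0, 1, 2, 3] (by decide) (by decide)
  have e15 := E 1 5 [1, 2, 3, 4] (by decide) (by decide)
  have e26 := E 2 6 [2, 3, 4, 5] (by decide) (by decide)
  have e37 := E 3 7 [3, 4, 5, 6] (by decide) (by decide)
  have e06 := E 0 6 [0, 1, 2, 3, 4, 5] (by decide) (by decide)
  have e17 := E 1 7 [1, 2, 3, 4, 5, 6] (by decide) (by decide)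
  simp only [List.map, List.sum_cons, List.sum_nil, add_zero] at e02 e13 e24 e35 e46 e57 e04 e15 e26 e37 e06 e17
  unfold SAW7
  rw [e02, e13, e24, e35, e46, e57, e04, e15, e26, e37, e06, e17, ← r0, ← r1, ← r2, ← r3, ← r4, ← r5, ← r6]
  simp only [saw7R, Bool.and_eq_true, Bool.not_eq_true', ← Bool.not_eq_true, ne_eq, z2_iff, z4_iff, z6_iff, add_assoc, and_assoc]

/-- ★ The raw tests decide the word-level classes on box tuples: `UnitTail3`. [cite: MadrasSlade1993, §4.2, remark after Theorem 4.2.4 (p. 94)] -/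
theorem unit3R_iff (t : Box7) : unit3R (q4 t) (q5 t) (q6 t) = true ↔ UnitTail3 (ofBox7 t) := by
  obtain ⟨r0, r1, r2, r3, r4, r5, r6⟩ := raw_ofBox7 t
  have E : ∀ (i : ℕ) (p : Fin 7) (l : List (Fin 7)), (blk7 i 7).erase p = l.toFinset → l.Nodup →
      esum7 (ofBox7 t) i p = (l.map fun q => twoStepV 7 (ofBox7 t q)).sum :=
    fun i p l h hl => sum_eq_list_sum _ l h hl _
  have e4 := E 4 4 [5, 6] (by decide) (by decide)
  have e5 := E 4 5 [4, 6] (by decide) (by decide)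
  have e6 := E 4 6 [4, 5] (by decide) (by decide)
  simp only [List.map, List.sum_cons, List.sum_nil, add_zero] at e4 e5 e6
  unfold UnitTail3
  rw [e4, e5, e6, ← r4, ← r5, ← r6]
  simp only [unit3R, Bool.or_eq_true, z2_iff, or_assoc]

/-- ★ The raw tests decide the word-level classes on box tuples: `UnitTail5`. [cite: MadrasSlade1993, §4.2, remark after Theorem 4.2.4 (p. 94)] -/
theorem unit5R_iff (t : Box7) : unit5R (q2 t) (q3 t) (q4 t) (q5 t) (q6 t) = true ↔ UnitTail5 (ofBox7 t) := by
  obtain ⟨r0, r1, r2, r3, r4, r5, r6⟩ := raw_ofBox7 t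
  have E : ∀ (i : ℕ) (p : Fin 7) (l : List (Fin 7)), (blk7 i 7).erase p = l.toFinset → l.Nodup →
      esum7 (ofBox7 t) i p = (l.map fun q => twoStepV 7 (ofBox7 t q)).sum :=
    fun i p l h hl => sum_eq_list_sum _ l h hl _
  have e2 := E 2 2 [3, 4, 5, 6] (by decide) (by decide)
  have e3 := E 2 3 [2, 4, 5, 6] (by decide) (by decide)
  have e4 := E 2 4 [2, 3, 5, 6] (by decide) (by decide)
  have e5 := E 2 5 [2, 3, 4, 6] (by decide) (by decide)
  have e6 := E 2 6 [2, 3, 4, 5] (by decide) (by decide)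
  simp only [List.map, List.sum_cons, List.sum_nil, add_zero] at e2 e3 e4 e5 e6
  unfold UnitTail5
  rw [e2, e3, e4, e5, e6, ← r2, ← r3, ← r4, ← r5, ← r6]
  simp only [unit5R, Bool.or_eq_true, z4_iff, add_assoc, or_assoc]

/-- ★ The raw tests decide the word-level classes on box tuples: `UnitTail7`. [cite: MadrasSlade1993, §4.2, remark after Theorem 4.2.4 (p. 94)] -/
theorem unit7R_iff (t : Box7) :
    unit7R (q0 t) (q1 t) (q2 t) (q3 t) (q4 t) (q5 t) (q6 t) = true ↔ UnitTail7 (ofBox7 t) := by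
  obtain ⟨r0, r1, r2, r3, r4, r5, r6⟩ := raw_ofBox7 t
  have E : ∀ (i : ℕ) (p : Fin 7) (l : List (Fin 7)), (blk7 i 7).erase p = l.toFinset → l.Nodup →
      esum7 (ofBox7 t) i p = (l.map fun q => twoStepV 7 (ofBox7 t q)).sum :=
    fun i p l h hl => sum_eq_list_sum _ l h hl _
  have e0 := E 0 0 [1, 2, 3, 4, 5, 6] (by decide) (by decide)
  have e1 := E 0 1 [0, 2, 3, 4, 5, 6] (by decide) (by decide)
  have e2 := E 0 2 [0, 1, 3, 4, 5, 6] (by decide) (by decide)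
  have e3 := E 0 3 [0, 1, 2, 4, 5, 6] (by decide) (by decide)
  have e4 := E 0 4 [0, 1, 2, 3, 5, 6] (by decide) (by decide)
  have e5 := E 0 5 [0, 1, 2, 3, 4, 6] (by decide) (by decide)
  have e6 := E 0 6 [0, 1, 2, 3, 4, 5] (by decide) (by decide)
  simp only [List.map, List.sum_cons, List.sum_nil, add_zero] at e0 e1 e2 e3 e4 e5 e6
  unfold UnitTail7
  rw [e0, e1, e2, e3, e4, e5, e6, ← r0, ← r1, ← r2, ← r3, ← r4, ← r5, ← r6]
  simp only [unit7R, Bool.or_eq_true, z6_iff, add_assoc, or_assoc]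

end classes

end WordTypes

end Literature.Probability.RandomPlanarGeometry.SAW.Zd
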